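import Summits.QuantumFields.BalabanUV.T4Continuum.Support.ShellMeasureLinearizedFromQ
import Summits.QuantumFields.BalabanUV.T4Continuum.Support.ShellMeasureLinearizedRealFormToy

/-!
# `T4Continuum.ShellMeasureLinearizedFromQToy` — NON-VACUITY of row S46 (`ShellMeasureLinearizedFromQ`) with a
# GENUINELY NONLINEAR average: the complexified PARABOLA `Q̃(B) = B₁ + B₀²` on `ℂ²`; the DERIVED `C̃` is `B₀²`, the
# DERIVED `D̃` is `B₀²`, and the END `exists_realForm_chartData_of_Q` FIRES
(cell `pub-balaban`, sub-cell `t4`, spine estimate NE7c (node U5b); NE7c ROUND-2 crew seat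
`b2b-balaban-t4-ne7c-formalise-leaf-08` gen 10 — companion TOY of the seat's own row S46 (owner table
`t4/b2b-balaban-t4-ne7c-p1/LEAVES-NE7c-P1.md` v2.0; journal `CLAIMS.log` INTENT «NON-VACUITY OF S46 WITH A GENUINELY
NONLINEAR Q̃»); imports S46 `ShellMeasureLinearizedFromQ` (p218633) and leaf-09-g8's S40-companion
`ShellMeasureLinearizedRealFormToy` (p218517: the conjugations `conj1`∕`conj2` = Mathlib `starₗᵢ ℂ` on `ℂ`∕`ℂ × ℂ` and
the right-inverse facts `snd_inr`, `norm_inr_le`, `inr_conj`) ONLY; [folklore]; ONE toy data `abbrev` (`toyQ`), 0 `def … : Prop`,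
0 sorry, 0 citations)

HONEST FRAMING.  A TOY: it asserts NOTHING about Bałaban's block averages, minimisers or densities (trigger c3); its
only purpose is to show that the hypothesis set (Q1)–(Q4) + `hop` of S46's `realForm_chartData_of_Q` is JOINTLY
INHABITED by a NONLINEAR analytic average (S46 §5's `example` is the linear `Qt = id`, where `C̃ = D̃ = 0`), and that
S46's DERIVED objects are the expected ones.  Finite four-torus programme, rung (B)+1 only — NOT infinite volume, NOT a
mass gap, NOT the Clay problem; «NE7c ⇐ the named binders»; NE7c NOT PRINTED, NOT PROVED; spine PROVED 0/9.  HONEST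
DEPENDENCY (cell, verbatim): continuum YM on T⁴ ⇐ BetaPertH ∧ nine spine estimates (0/9 proved); BetaPertH ⇐ (D1) ∧
(D4) ∧ CAP+tail; G-an2-4 gates asym, D1 and NE2/3/4.

THE TOY.  `𝒴 = ℂ × ℂ`, `𝒳 = ℂ` (sup norm), conjugations `κ_𝒴 = conj2`, `κ_𝒳 = conj1` (componentwise complex
conjugation), the AVERAGE `Q̃(B) = B₁ + B₀²` (`toyQ`; its real points are the parabola-fibred `ℝ²` of
`ShellMeasureLinearizedToy` ∕ `…RealFormToy`), `hop X = (0, X)` (`LinearMap.inr`).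
* §1 (Q1)–(Q4) + `hop`: `Q̃` is entire (`toyQ_analyticOnNhd`), `Q̃(0) = 0`, `‖Q̃‖ ≤ 2` on `ball 0 1`, `Q̃ ∘ conj2 =
  conj1 ∘ Q̃`; `DQ̃(0) = pr₂` COMPUTED (`hasFDerivAt_toyQ_zero`, `fderiv_toyQ_zero`), so «LQ̃h = I» is `pr₂ (0, X) = X`;
  the numbers: `Mq 1 2 = 4`, `ε = 1∕40`, `9·4·1·(1∕40) < 1`, `3∕40 ≤ 1`.
* §2 THE DERIVED OBJECTS: `nonlin toyQ = fun Y => Y.1 ^ 2` (`nonlin_toyQ` — the S40 toy's POSITED `C̃` is S46's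
  DERIVED one) and ANY solution `D̃` of S46's fixed-point equation in the ball `4·(Mq 1 2)·ε²` on the window IS
  `B ↦ B₀²` there (`Dt_eq_sq`, by «exactly one solution» `B12Lineariz267.eq_Dt_of_fixedPt`).
* §3 FIRE: **`toy_exists_realForm_chartData_of_Q`** — a splitting `Ψ` with `(Ψ.symm y).2 = L y` EXISTS
  (`ShellMeasureLinearizedConstraint.exists_splitting_of_rightInverse` + S36 `realForm_rightInverse`, leaf-09-g8's
  pattern) and S46's `exists_realForm_chartData_of_Q` yields `D̃` with the four real-chart clauses on the window
  `‖ι B‖ < 1∕40` of `Fix(conj2) = ℝ²` and `Q̃(B − hop (D̃ B)) = B₁` — every analytic binder DERIVED from `toyQ` (one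
  application, no hypothesis left).
-/

noncomputable section

open Set Metric Filter Topology

namespace Summit.QuantumFields.BalabanUV.T4Continuum.ShellMeasureLinearizedFromQToy

open Literature.MathematicalPhysics.QuantumFieldTheory.Balaban1983to89
open B12Lineariz267 (eq_Dt_of_fixedPt)
open Summit.QuantumFields.BalabanUV.Beta.LinearizingChange267FromQ (nonlin Mq)
open ShellMeasureLinearizedRealStructure (realSub incl reP incl_reP_of_fixed conj_incl reP_incl)
open ShellMeasureLinearizedRealForm (realForm_rightInverse)
open ShellMeasureLinearizedConstraint (exists_splitting_of_rightInverse)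
open ShellMeasureLinearizedRealFormToy (conj1 conj2 conj1_conj1 conj2_conj2 snd_inr norm_inr_le inr_conj)
open ShellMeasureLinearizedFromQ (quadAnalytic_nonlin_of_Q Mq_nonneg_of_Q exists_realForm_chartData_of_Q)

/-! ## §1 The average `Q̃(B) = B₁ + B₀²` and the hypotheses (Q1)–(Q4) + `hop` -/

/-- the toy average `Q̃(B) = B₁ + B₀²` on `ℂ²` (toy data; an `abbrev`, unfolded by `rfl`). [folklore] -/
abbrev toyQ : ℂ × ℂ → ℂ := fun B => B.2 + B.1 ^ 2

/-- (Q1) `Q̃` is analytic everywhere (a polynomial in the coordinates). [folklore] -/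
theorem toyQ_analyticOnNhd (s : Set (ℂ × ℂ)) : AnalyticOnNhd ℂ toyQ s := fun Y _ =>
  ((ContinuousLinearMap.snd ℂ ℂ ℂ).analyticAt Y).add (((ContinuousLinearMap.fst ℂ ℂ ℂ).analyticAt Y).pow 2)

/-- (Q2) `Q̃(0) = 0`. [folklore] -/
theorem toyQ_zero : toyQ 0 = 0 := by simp [toyQ]

/-- (Q3) `‖Q̃ B‖ ≤ 2` on the unit ball (`‖B₁‖ ≤ 1`, `‖B₀‖² ≤ 1`). [folklore] -/
theorem toyQ_bound : ∀ B ∈ ball (0 : ℂ × ℂ) 1, ‖toyQ B‖ ≤ 2 := by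
  intro B hB
  rw [mem_ball_zero_iff] at hB
  show ‖B.2 + B.1 ^ 2‖ ≤ 2
  have h1 : ‖B.1‖ ≤ 1 := (norm_fst_le B).trans hB.le
  have h2 : ‖B.2‖ ≤ 1 := (norm_snd_le B).trans hB.le
  calc ‖B.2 + B.1 ^ 2‖ ≤ ‖B.2‖ + ‖B.1 ^ 2‖ := norm_add_le _ _
    _ = ‖B.2‖ + ‖B.1‖ ^ 2 := by rw [norm_pow]
    _ ≤ 1 + 1 := add_le_add h2 (by nlinarith [norm_nonneg B.1])
    _ = 2 := by norm_num

/-- (Q4) `Q̃` is conjugation-EQUIVARIANT: `Q̃(conj2 B) = conj1 (Q̃ B)` (real coefficients). [folklore] -/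
theorem toyQ_conj : ∀ B ∈ ball (0 : ℂ × ℂ) 1, toyQ (conj2 B) = conj1 (toyQ B) := fun B _ => by
  simp only [toyQ, starₗᵢ_apply, Prod.fst_star, Prod.snd_star, star_add, star_pow]

/-- `DQ̃(0) = pr₂`: the derivative of `B₁ + B₀²` at `0` (the square contributes `2·0·pr₁ = 0`). [folklore] -/
theorem hasFDerivAt_toyQ_zero : HasFDerivAt toyQ (ContinuousLinearMap.snd ℂ ℂ ℂ) 0 := by
  have h1 : HasFDerivAt (fun B : ℂ × ℂ => B.2) (ContinuousLinearMap.snd ℂ ℂ ℂ) (0 : ℂ × ℂ) := hasFDerivAt_snd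
  have h2 := (hasFDerivAt_fst (𝕜 := ℂ) (E := ℂ) (F := ℂ) (p := (0 : ℂ × ℂ))).pow 2
  refine (h1.add h2).congr_fderiv ?_
  simp

/-- `fderiv ℂ Q̃ 0 = pr₂`. [folklore] -/
theorem fderiv_toyQ_zero : fderiv ℂ toyQ 0 = ContinuousLinearMap.snd ℂ ℂ ℂ := hasFDerivAt_toyQ_zero.fderiv

/-- «LQ̃h = I» for `hop = inr`: `DQ̃(0) (0, X) = X`. [folklore] -/
theorem toyQ_hLQh : ∀ X : ℂ, fderiv ℂ toyQ 0 ((LinearMap.inr ℂ ℂ ℂ) X) = X := fun X => by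
  rw [fderiv_toyQ_zero]; exact snd_inr X

/-- the quadratic constant of the toy: `Mq 1 2 = 2·2∕1² = 4`. [folklore] -/
theorem Mq_toy : Mq 1 2 = 4 := by norm_num [Mq]

/-- the contraction regime `9·C₂·b·ε < 1` at `ε = 1∕40`: `36∕40 < 1`. [folklore] -/
theorem toy_hq : 9 * Mq 1 2 * 1 * (1 / 40) < 1 := by rw [Mq_toy]; norm_num

/-- the coupling `3ε ≤ R`: `3∕40 ≤ 1`. [folklore] -/
theorem toy_hRC : 3 * (1 / 40 : ℝ) ≤ 1 := by norm_num

/-! ## §2 The derived objects: `C̃ = B₀²`, `D̃ = B₀²` -/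

/-- **S46's DERIVED NON-LINEAR PART IS THE S40-TOY's POSITED ONE**: `nonlin Q̃ = Q̃ − DQ̃(0) = (B ↦ B₀²)`. [folklore] -/
theorem nonlin_toyQ : nonlin toyQ = fun Y : ℂ × ℂ => Y.1 ^ 2 := by
  funext Y
  simp only [nonlin, fderiv_toyQ_zero, ContinuousLinearMap.coe_snd', add_sub_cancel_left]

/-- `B ↦ B₀²` solves S46's fixed-point equation `C̃(B − hop D) = D` for `C̃ = nonlin Q̃`, `hop = inr`. [folklore] -/
theorem sq_solves (B : ℂ × ℂ) : nonlin toyQ (B - (LinearMap.inr ℂ ℂ ℂ) (B.1 ^ 2)) = B.1 ^ 2 := by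
  rw [nonlin_toyQ]
  simp only [LinearMap.inr_apply, Prod.fst_sub, sub_zero]

/-- `B₀²` lies in the ball `4·C₂·ε²` (`C₂ = 4`, `ε = 1∕40`) for `‖B‖ < 1∕40`. [folklore] -/
theorem sq_mem_ball (B : ℂ × ℂ) (hB : ‖B‖ < 1 / 40) :
    B.1 ^ 2 ∈ closedBall (0 : ℂ) (4 * Mq 1 2 * (1 / 40) ^ 2) := by
  rw [Mq_toy, mem_closedBall, dist_zero_right, norm_pow]
  have h1 : ‖B.1‖ ≤ 1 / 40 := (norm_fst_le B).trans hB.le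
  have h0 : 0 ≤ ‖B.1‖ := norm_nonneg _
  nlinarith

/-- **THE ABSTRACT `D̃` OF S46 IS `B ↦ B₀²` IN THE MODEL**: any solution `D̃` of the fixed-point equation valued in the
ball `4·C₂·ε²` on the window agrees with `B₀²` there — «exactly one solution» (`B12Lineariz267.eq_Dt_of_fixedPt` with
S46's `quadAnalytic_nonlin_of_Q`). [folklore] -/
theorem Dt_eq_sq {Dt : ℂ × ℂ → ℂ}
    (hDball : ∀ B : ℂ × ℂ, ‖B‖ < 1 / 40 → Dt B ∈ closedBall (0 : ℂ) (4 * Mq 1 2 * (1 / 40) ^ 2))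
    (hDfix : ∀ B : ℂ × ℂ, ‖B‖ < 1 / 40 → nonlin toyQ (B - (LinearMap.inr ℂ ℂ ℂ) (Dt B)) = Dt B)
    {B : ℂ × ℂ} (hB : ‖B‖ < 1 / 40) : Dt B = B.1 ^ 2 :=
  (eq_Dt_of_fixedPt (quadAnalytic_nonlin_of_Q one_pos (toyQ_analyticOnNhd _) toyQ_bound toyQ_zero)
    (Mq_nonneg_of_Q one_pos toyQ_bound) zero_le_one norm_inr_le toy_hq toy_hRC hDball hDfix hB (sq_mem_ball B hB)
    (sq_solves B)).symm

/-! ## §3 FIRE: S46's END on the toy, every analytic binder derived -/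

/-- **NON-VACUITY OF ROW S46 WITH A NONLINEAR AVERAGE.**  For `Q̃(B) = B₁ + B₀²` on `ℂ²` with componentwise
conjugation, `hop = inr`, `R = 1`, `M_Q = 2`, `b = 1`, `ε = 1∕40`: a real splitting `Ψ : ker L × Fix(conj1) ≃ Fix(conj2)`
with `(Ψ.symm y).2 = L y`, `L := reP conj1 ∘ DQ̃(0)↾ℝ ∘ incl conj2`, EXISTS, and S46's `exists_realForm_chartData_of_Q`
produces `D̃` — in the ball, solving print's fixed-point equation for the DERIVED `C̃ = nonlin Q̃`, linearizing `Q̃`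
ITSELF (`Q̃(B − hop (D̃ B)) = DQ̃(0) B`) — whose real chart `B ↦ B − h (D̃_ℝ B)` on `Fix(conj2) = ℝ²` is measurable,
injective on the real window `‖ι B‖ < 1∕40`, differentiable within it, and linearizes the real average into
`(Ψ.symm B).2`.  NO analytic hypothesis is left: (Q1)–(Q4) + `hop` are §1's theorems. [folklore] -/
theorem toy_exists_realForm_chartData_of_Q :
    ∃ (Ψ : (LinearMap.ker ((reP conj1 conj1_conj1 ∘L (fderiv ℂ toyQ 0).restrictScalars ℝ ∘L incl conj2) :
        realSub conj2 →ₗ[ℝ] realSub conj1) × realSub conj1) ≃L[ℝ] realSub conj2) (Dt : ℂ × ℂ → ℂ),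
      (∀ y, (Ψ.symm y).2 = (reP conj1 conj1_conj1 ∘L (fderiv ℂ toyQ 0).restrictScalars ℝ ∘L incl conj2) y) ∧
      (∀ B : ℂ × ℂ, ‖B‖ < 1 / 40 → Dt B ∈ closedBall (0 : ℂ) (4 * Mq 1 2 * (1 / 40) ^ 2) ∧
        nonlin toyQ (B - (LinearMap.inr ℂ ℂ ℂ) (Dt B)) = Dt B ∧
        toyQ (B - (LinearMap.inr ℂ ℂ ℂ) (Dt B)) = fderiv ℂ toyQ 0 B) ∧
      Measurable (fun B : realSub conj2 => B - (reP conj2 conj2_conj2 ∘L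
          ((LinearMap.inr ℂ ℂ ℂ).mkContinuous 1 norm_inr_le).restrictScalars ℝ ∘L incl conj1)
          (({y : realSub conj2 | ‖incl conj2 y‖ < 1 / 40}).piecewise
            (fun y => reP conj1 conj1_conj1 (Dt (incl conj2 y))) 0 B)) ∧
      InjOn (fun B : realSub conj2 => B - (reP conj2 conj2_conj2 ∘L
          ((LinearMap.inr ℂ ℂ ℂ).mkContinuous 1 norm_inr_le).restrictScalars ℝ ∘L incl conj1)
          (({y : realSub conj2 | ‖incl conj2 y‖ < 1 / 40}).piecewise
            (fun y => reP conj1 conj1_conj1 (Dt (incl conj2 y))) 0 B))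
          {y : realSub conj2 | ‖incl conj2 y‖ < 1 / 40} ∧
      (∀ B ∈ {y : realSub conj2 | ‖incl conj2 y‖ < 1 / 40}, HasFDerivWithinAt
          (fun B : realSub conj2 => B - (reP conj2 conj2_conj2 ∘L
            ((LinearMap.inr ℂ ℂ ℂ).mkContinuous 1 norm_inr_le).restrictScalars ℝ ∘L incl conj1)
            (({y : realSub conj2 | ‖incl conj2 y‖ < 1 / 40}).piecewise
              (fun y => reP conj1 conj1_conj1 (Dt (incl conj2 y))) 0 B))
          (ContinuousLinearMap.id ℝ (realSub conj2) - (reP conj2 conj2_conj2 ∘L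
            ((LinearMap.inr ℂ ℂ ℂ).mkContinuous 1 norm_inr_le).restrictScalars ℝ ∘L incl conj1).comp
            (reP conj1 conj1_conj1 ∘L (fderiv ℂ Dt (incl conj2 B)).restrictScalars ℝ ∘L incl conj2))
          {y : realSub conj2 | ‖incl conj2 y‖ < 1 / 40} B) ∧
      ∀ B ∈ {y : realSub conj2 | ‖incl conj2 y‖ < 1 / 40},
          (reP conj1 conj1_conj1 ∘L (fderiv ℂ toyQ 0).restrictScalars ℝ ∘L incl conj2) (B - (reP conj2 conj2_conj2 ∘L
              ((LinearMap.inr ℂ ℂ ℂ).mkContinuous 1 norm_inr_le).restrictScalars ℝ ∘L incl conj1)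
              (({y : realSub conj2 | ‖incl conj2 y‖ < 1 / 40}).piecewise
                (fun y => reP conj1 conj1_conj1 (Dt (incl conj2 y))) 0 B)) +
            (fun y => reP conj1 conj1_conj1 (nonlin toyQ (incl conj2 y))) (B - (reP conj2 conj2_conj2 ∘L
              ((LinearMap.inr ℂ ℂ ℂ).mkContinuous 1 norm_inr_le).restrictScalars ℝ ∘L incl conj1)
              (({y : realSub conj2 | ‖incl conj2 y‖ < 1 / 40}).piecewise
                (fun y => reP conj1 conj1_conj1 (Dt (incl conj2 y))) 0 B)) = (Ψ.symm B).2 := by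
  obtain ⟨Ψ, -, hΨ⟩ := exists_splitting_of_rightInverse
    (reP conj1 conj1_conj1 ∘L (fderiv ℂ toyQ 0).restrictScalars ℝ ∘L incl conj2)
    (reP conj2 conj2_conj2 ∘L ((LinearMap.inr ℂ ℂ ℂ).mkContinuous 1 norm_inr_le).restrictScalars ℝ ∘L incl conj1)
    (realForm_rightInverse (fderiv ℂ toyQ 0) toyQ_hLQh norm_inr_le inr_conj
      (incl_reP_of_fixed conj2_conj2) (conj_incl conj1) (reP_incl conj1_conj1))
  obtain ⟨Dt, hDt, h1, h2, h3, h4⟩ := exists_realForm_chartData_of_Q conj1_conj1 conj2_conj2 one_pos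
    (toyQ_analyticOnNhd _) toyQ_zero toyQ_bound toyQ_conj toyQ_hLQh zero_le_one norm_inr_le inr_conj toy_hq toy_hRC
    Ψ hΨ
  exact ⟨Ψ, Dt, hΨ, hDt, h1, h2, h3, h4⟩

/-- … and in that conclusion the abstract `D̃` may be REPLACED by `B₀²` on the window (§2 `Dt_eq_sq`), so the real
chart is the parabola substitution `(y₀, y₁) ↦ (y₀, y₁ − y₀²)` of `ShellMeasureLinearizedRealFormToy.toy_realChart_eq`
∕ `ShellMeasureLinearizedToy` — the linear fibre `{B₁ = b}` is carried onto the parabola `{B₁ + B₀² = b}`: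
`Q̃(B − hop (D̃ B)) = B₁`. [folklore] -/
theorem toy_linearizes {Dt : ℂ × ℂ → ℂ}
    (hDball : ∀ B : ℂ × ℂ, ‖B‖ < 1 / 40 → Dt B ∈ closedBall (0 : ℂ) (4 * Mq 1 2 * (1 / 40) ^ 2))
    (hDfix : ∀ B : ℂ × ℂ, ‖B‖ < 1 / 40 → nonlin toyQ (B - (LinearMap.inr ℂ ℂ ℂ) (Dt B)) = Dt B)
    {B : ℂ × ℂ} (hB : ‖B‖ < 1 / 40) :
    B - (LinearMap.inr ℂ ℂ ℂ) (Dt B) = (B.1, B.2 - B.1 ^ 2) ∧ toyQ (B - (LinearMap.inr ℂ ℂ ℂ) (Dt B)) = B.2 := by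
  rw [Dt_eq_sq hDball hDfix hB]
  refine ⟨?_, ?_⟩
  · ext <;> simp [LinearMap.inr_apply]
  · simp only [toyQ, LinearMap.inr_apply, Prod.snd_sub, Prod.fst_sub, sub_zero, sub_add_cancel]

end Summit.QuantumFields.BalabanUV.T4Continuum.ShellMeasureLinearizedFromQToy

end
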